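import Mathlib
import Literature.NumberTheory.LFunctions.SmoothNumbersGcdFibres
import Literature.NumberTheory.Transcendental.ErdosConjectureOkadaProofs
import HarnessLib

/-!
# Erdős's conjecture: the divisor bound `1 ≤ Σ_{d∣q, d≥3} 1/φ(d)` (Chatterjee–Murty 2015, Prop. 3.1 and Cor. 3.3)

Topic `Literature/NumberTheory/Transcendental`; namespace `Literature.NumberTheory.Transcendental.OkadaCriterion`.
THEOREMS only (no definition, no named fact, no `sorry`); cell pub-zeta5, P1 g58. Sequel of
`ErdosConjectureOkadaProofs.lean` (Okada's `2φ(q)+1 > q`) using the `gcd`-fibres of `SmoothNumbersGcdFibres.lean`.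

## Source (read on the page)

T. Chatterjee, M. Ram Murty, *On a conjecture of Erdős and certain Dirichlet series*, Pacific J. Math. **275** (2015)
103–113 [ChatterjeeMurty2015] (arXiv:1501.04185), §3 «Exceptions to the conjecture of Erdős»: «We say that the
Erdős conjecture is false (mod `q`), if there is an Erdősian function `f` for which `L(1,f) = 0`. …
**Proposition 3.1.** If the Erdős conjecture is false (mod `q`) with `q` odd, then `1 ≤ Σ_{d∣q, d≥3} 1/φ(d)`.
*Proof.* … Applying Okada's criterion, we get `Σ_{b∈M(q)} f(b)/b = 0`. Let `d = (b,q)`, so that `b = db₁` with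
`(b₁, q/d) = 1`. Then … `−f(1) = Σ_{d∣q, d≥3} (1/d) Σ_{b₁∈M(q), (b₁,q/d)=1} f(db₁)/b₁`. Taking absolute value …
`1 ≤ Σ_{d∣q, d≥3} (1/d) Σ_{b₁∈M(d)} 1/b₁` … `= Σ 1/φ(d)`. … **Corollary 3.3.** If the smallest prime factor of `q` is
at least `d(q)`, then the Erdős conjecture is true for `q`. … Note that, the Corollary 3.3 was not known previously.
It implies that the conjecture is true for any squarefree number `q` with `k` prime factors, provided the smallest
prime factor of `q` is greater than `2^k`.»

## What is proved (`N ≥ 2`; «Erdősian» = `f(0) = 0`, `f = ±1` else; `M(N)` = `Nat.factoredNumbers N.primeFactors`)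

* `tsum_indicator_gcd_eq'`, **`tsum_indicator_gcd_inv_le`** — the fibre mass `μ_d = Σ_{m∈M(N), gcd(m,N)=d} 1/m` is
  `≤ 1/φ(d)` (`μ_d = d⁻¹Σ_{n∈M(P(d))} 1/n ≤ d⁻¹Σ_{n∈M(d)} 1/n = 1/φ(d)`);
* **`one_le_sum_inv_totient_of_tsum_eq_zero`**, **`one_le_sum_inv_totient_of_LFunction_one_eq_zero`** —
  PROPOSITION 3.1 in the sharper form `1 ≤ Σ_{d∣N, 1<d<N} 1/φ(d)` for every `N ≥ 2` (from Okada's first condition /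
  from `L(1,f) = 0` via Okada's criterion), and `one_le_sum_inv_totient_of_odd` — the printed form for odd `q`;
* `minFac_sub_one_le_totient` — `φ(d) ≥ minFac(N) − 1` for `1 < d ∣ N`;
* **`erdos_conjecture_of_card_divisors_le_minFac`** — COROLLARY 3.3 (series form, no convergence hypothesis).

HONEST FRAMING: printed 2015 results made kernel theorems on the tree's proved Baker theorem; Erdős's conjecture in
general stays OPEN (not typed); nothing here concerns `ζ(5)`.
-/

noncomputable section

open Complex Finset Filter Topology
open Literature.NumberTheory.LFunctions.ChatterjeeMurty2014
open Literature.NumberTheory.LFunctions.PeriodicLSeries (tendsto_sum_range_div not_tendsto_sum_range_div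
  eq_LFunction_one_of_tendsto)

namespace Literature.NumberTheory.Transcendental

namespace OkadaCriterion

variable {N : ℕ} [NeZero N]

/-! ### The fibre masses are at most `1/φ(d)` -/

/-- Fibre sums, for a general target monoid: `Σ_{m∈M(N), gcd(m,N)=d} w(m) = Σ_{n∈M(P(d))} w(dn)` (`d ∣ N`).
[cite: Tijdeman2002, Appendix, Theorem 8 (the inner sums over `S(d)`)] -/
theorem tsum_indicator_gcd_eq' {α : Type*} [AddCommMonoid α] [TopologicalSpace α] {d : ℕ} (hd : d ∣ N)
    (w : ℕ → α) :
    ∑' m : Nat.factoredNumbers N.primeFactors, (if Nat.gcd (m : ℕ) N = d then w m else 0) =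
      ∑' n : Nat.factoredNumbers (N.primeFactors.filter (fun p => ¬ p ∣ N / d)), w (d * n) := by
  classical
  let ι : Nat.factoredNumbers (N.primeFactors.filter (fun p => ¬ p ∣ N / d)) →
      Nat.factoredNumbers N.primeFactors :=
    fun n => ⟨d * n, ((mem_factoredNumbers_and_gcd_eq_iff hd (d * n)).mpr ⟨n, n.2, rfl⟩).1⟩
  have hd0 : d ≠ 0 := fun h => (NeZero.ne N) (by rw [h] at hd; exact zero_dvd_iff.mp hd)
  have hι : Function.Injective ι := by
    rintro ⟨n₁, _⟩ ⟨n₂, _⟩ h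
    have h' : d * n₁ = d * n₂ := congrArg Subtype.val h
    exact Subtype.ext (Nat.eq_of_mul_eq_mul_left (Nat.pos_of_ne_zero hd0) h')
  have hsupp : Function.support (fun m : Nat.factoredNumbers N.primeFactors =>
      if Nat.gcd (m : ℕ) N = d then w m else 0) ⊆ Set.range ι := by
    intro m hm
    rw [Function.mem_support] at hm
    have hg : Nat.gcd (m : ℕ) N = d := by
      by_contra h
      exact hm (if_neg h)
    obtain ⟨n, hn, hmn⟩ := (mem_factoredNumbers_and_gcd_eq_iff hd (m : ℕ)).mp ⟨m.2, hg⟩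
    exact ⟨⟨n, hn⟩, Subtype.ext hmn.symm⟩
  rw [← hι.tsum_eq hsupp]
  refine tsum_congr fun n => ?_
  have hg : Nat.gcd (d * (n : ℕ)) N = d := ((mem_factoredNumbers_and_gcd_eq_iff hd (d * n)).mpr ⟨n, n.2, rfl⟩).2
  simp only [ι, hg, if_true]

/-- **`μ_d ≤ 1/φ(d)`**: `Σ_{m∈M(N), gcd(m,N)=d} 1/m = d⁻¹Σ_{n∈M(P(d))} 1/n ≤ d⁻¹Σ_{n∈M(d)} 1/n = 1/φ(d)` for a
divisor `d` of `N` («`Σ_{b₁∈M(d)} 1/b₁ = Π_{p∣d}(1 − 1/p)⁻¹ = d/φ(d)`»; `P(d) ⊆` the primes of `d`).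
[cite: ChatterjeeMurty2015, §3 (proof of Proposition 3.1, display (12))] -/
theorem tsum_indicator_gcd_inv_le {d : ℕ} (hd : d ∣ N) :
    ∑' m : Nat.factoredNumbers N.primeFactors, (if Nat.gcd (m : ℕ) N = d then ((m : ℕ) : ℝ)⁻¹ else 0) ≤
      1 / (d.totient : ℝ) := by
  have hN : N ≠ 0 := NeZero.ne N
  have hd0 : d ≠ 0 := fun h => hN (by rw [h] at hd; exact zero_dvd_iff.mp hd)
  haveI : NeZero d := ⟨hd0⟩
  have hNd : d * (N / d) = N := Nat.mul_div_cancel' hd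
  -- `P(d) ⊆ primes of d`
  have hsub : N.primeFactors.filter (fun p => ¬ p ∣ N / d) ⊆ d.primeFactors := by
    intro p hp
    obtain ⟨hpN, hpnd⟩ := Finset.mem_filter.mp hp
    have hpp := Nat.prime_of_mem_primeFactors hpN
    have hpdvd : p ∣ d * (N / d) := by rw [hNd]; exact Nat.dvd_of_mem_primeFactors hpN
    rcases (Nat.Prime.dvd_mul hpp).mp hpdvd with h | h
    · exact Nat.mem_primeFactors.mpr ⟨hpp, h, hd0⟩
    · exact (hpnd h).elim
  have hP : ∀ p ∈ N.primeFactors.filter (fun p => ¬ p ∣ N / d), p.Prime := fun p hp =>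
    Nat.prime_of_mem_primeFactors (Finset.mem_filter.mp hp).1
  rw [tsum_indicator_gcd_eq' hd (fun m : ℕ => ((m : ℕ) : ℝ)⁻¹)]
  -- compare with the sum over `M(d)` through the inclusion
  let e : Nat.factoredNumbers (N.primeFactors.filter (fun p => ¬ p ∣ N / d)) → Nat.factoredNumbers d.primeFactors :=
    fun n => ⟨n, Nat.factoredNumbers_mono hsub n.2⟩
  have he : Function.Injective e := fun a b h => Subtype.ext (by simpa [e] using congrArg Subtype.val h)
  have hsum1 : Summable fun n : Nat.factoredNumbers (N.primeFactors.filter (fun p => ¬ p ∣ N / d)) =>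
      ((d * (n : ℕ) : ℕ) : ℝ)⁻¹ := by
    have h := (summable_factoredNumbers_rpow_neg' _ hP (σ := 1) one_pos).mul_left ((d : ℝ)⁻¹)
    refine h.congr fun n => ?_
    rw [Real.rpow_neg_one]; push_cast; rw [mul_inv]
  have hsum2 : Summable fun n : Nat.factoredNumbers d.primeFactors => (d : ℝ)⁻¹ * ((n : ℕ) : ℝ)⁻¹ :=
    (summable_factoredNumbers_inv (N := d)).mul_left _
  have hle := Summable.tsum_le_tsum_of_inj e he (fun c _ => by positivity)
    (fun n => by
      show ((d * (n : ℕ) : ℕ) : ℝ)⁻¹ ≤ (d : ℝ)⁻¹ * (((e n : Nat.factoredNumbers d.primeFactors) : ℕ) : ℝ)⁻¹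
      push_cast; rw [mul_inv]) hsum1 hsum2
  refine hle.trans (le_of_eq ?_)
  rw [tsum_mul_left, (hasSum_factoredNumbers_inv (N := d)).tsum_eq]
  have hφ : (d.totient : ℝ) ≠ 0 := by exact_mod_cast (Nat.totient_pos.mpr (NeZero.pos d)).ne'
  field_simp


/-! ### Proposition 3.1: `1 ≤ Σ_{d∣q, 1<d<q} 1/φ(d)` when an Erdősian `f` has `Σ_{m∈M(q)} f(m)/m = 0` -/

omit [NeZero N] in
/-- Splitting a sum over `M(N)` along the fibres of `gcd(·, N)`. [folklore] -/
private theorem tsum_eq_sum_divisors_tsum_ite (hN : N ≠ 0) (g : Nat.factoredNumbers N.primeFactors → ℝ)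
    (hg : Summable g) :
    ∑' m, g m = ∑ d ∈ N.divisors, ∑' m : Nat.factoredNumbers N.primeFactors,
      (if Nat.gcd (m : ℕ) N = d then g m else 0) := by
  classical
  have hpt : ∀ m : Nat.factoredNumbers N.primeFactors,
      g m = ∑ d ∈ N.divisors, (if Nat.gcd (m : ℕ) N = d then g m else 0) := by
    intro m
    have hmem : Nat.gcd (m : ℕ) N ∈ N.divisors := Nat.mem_divisors.mpr ⟨Nat.gcd_dvd_right _ _, hN⟩
    rw [Finset.sum_eq_single_of_mem (Nat.gcd (m : ℕ) N) hmem (fun d _ hne => if_neg (Ne.symm hne)), if_pos rfl]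
  have hsum : ∀ d ∈ N.divisors, Summable fun m : Nat.factoredNumbers N.primeFactors =>
      (if Nat.gcd (m : ℕ) N = d then g m else 0) := fun d _ =>
    Summable.of_norm_bounded hg.norm fun m => by split_ifs <;> simp
  rw [tsum_congr hpt, Summable.tsum_finsetSum hsum]

/-- **Chatterjee–Murty 2015, Proposition 3.1 (core, any `q ≥ 2`).** If `f : ℤ/N → ℂ` has `f(0) = 0`, `f = ±1`
elsewhere, and `Σ_{m∈M(N)} f(m)/m = 0` (Okada's first condition at `a = 1`), then
`1 ≤ Σ_{d∣N, 1<d<N} 1/φ(d)`: `1 = |f(1)| ≤ Σ_{m∈M(N), m>1, N∤m} 1/m = Σ_{1<d<N} μ_d ≤ Σ_{1<d<N} 1/φ(d)`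
(«Let `d = (b,q)`, so that `b = db₁` … Taking absolute value of both sides … `Σ_{b₁∈M(d)} 1/b₁ = d/φ(d)`»).
[cite: ChatterjeeMurty2015, Proposition 3.1] -/
theorem one_le_sum_inv_totient_of_tsum_eq_zero (hN : 2 ≤ N) (Φ : ZMod N → ℂ) (h0 : Φ 0 = 0)
    (hpm : ∀ b : ZMod N, b ≠ 0 → Φ b = 1 ∨ Φ b = -1)
    (hG : ∑' m : Nat.factoredNumbers N.primeFactors, Φ ((m : ℕ) : ZMod N) / ((m : ℕ) : ℂ) = 0) :
    (1 : ℝ) ≤ ∑ d ∈ N.divisors.filter (fun d => 1 < d ∧ d < N), 1 / (d.totient : ℝ) := by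
  classical
  haveI : Fact (1 < N) := ⟨hN⟩
  have hN0 : N ≠ 0 := NeZero.ne N
  have h1M : (1 : ℕ) ∈ Nat.factoredNumbers N.primeFactors :=
    Nat.mem_factoredNumbers'.mpr fun p hp hp1 => (hp.ne_one (Nat.dvd_one.mp hp1)).elim
  have hnorm : ∀ b : ZMod N, ‖Φ b‖ ≤ 1 := by
    intro b
    by_cases hb : b = 0
    · rw [hb, h0, norm_zero]; exact zero_le_one
    · rcases hpm b hb with h | h <;> rw [h] <;> simp
  have hsum : Summable fun m : Nat.factoredNumbers N.primeFactors => Φ ((m : ℕ) : ZMod N) / ((m : ℕ) : ℂ) :=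
    summable_factoredNumbers_div (c := fun n : ℕ => Φ (n : ZMod N)) (fun n => hnorm _)
  have hsplit := hsum.tsum_eq_add_tsum_ite ⟨1, h1M⟩
  rw [hG] at hsplit
  have hΦ1 : ‖Φ 1‖ = 1 := by
    rcases hpm 1 one_ne_zero with h | h <;> rw [h] <;> simp
  -- the majorant `B(m) = [1 < gcd(m,N) < N]/m`
  set B : Nat.factoredNumbers N.primeFactors → ℝ := fun m =>
    if 1 < Nat.gcd (m : ℕ) N ∧ Nat.gcd (m : ℕ) N < N then ((m : ℕ) : ℝ)⁻¹ else 0 with hB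
  have hBsum : Summable B :=
    Summable.of_norm_bounded (summable_factoredNumbers_inv (N := N)) fun m => by
      simp only [hB]; split_ifs <;> simp
  have hle : ∀ m : Nat.factoredNumbers N.primeFactors,
      ‖(if m = ⟨1, h1M⟩ then (0 : ℂ) else Φ ((m : ℕ) : ZMod N) / ((m : ℕ) : ℂ))‖ ≤ B m := by
    intro m
    have hBnn : 0 ≤ B m := by simp only [hB]; split_ifs <;> positivity
    by_cases hm1 : m = ⟨1, h1M⟩
    · rw [if_pos hm1, norm_zero]; exact hBnn
    · rw [if_neg hm1]
      have hm1' : (m : ℕ) ≠ 1 := fun h => hm1 (Subtype.ext h)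
      by_cases hd : N ∣ (m : ℕ)
      · have hz : Φ ((m : ℕ) : ZMod N) = 0 := by rw [(ZMod.natCast_eq_zero_iff (m : ℕ) N).mpr hd, h0]
        rw [hz, zero_div, norm_zero]; exact hBnn
      · -- `1 < gcd(m,N) < N`
        have hg1 : 1 < Nat.gcd (m : ℕ) N := by
          obtain ⟨p, hp, hpm'⟩ := Nat.exists_prime_and_dvd hm1'
          have hpN : p ∣ N := Nat.dvd_of_mem_primeFactors (Nat.mem_factoredNumbers'.mp m.2 p hp hpm')
          exact lt_of_lt_of_le hp.one_lt (Nat.le_of_dvd (Nat.gcd_pos_of_pos_right _ (NeZero.pos N))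
            (Nat.dvd_gcd hpm' hpN))
        have hgN : Nat.gcd (m : ℕ) N < N := by
          refine lt_of_le_of_ne (Nat.le_of_dvd (NeZero.pos N) (Nat.gcd_dvd_right _ _)) fun h => hd ?_
          have hdl := Nat.gcd_dvd_left (m : ℕ) N
          rwa [h] at hdl
        simp only [hB, hg1, hgN, and_self, if_true]
        rw [norm_div, Complex.norm_natCast, div_eq_mul_inv]
        exact mul_le_of_le_one_left (inv_nonneg.mpr (Nat.cast_nonneg _)) (hnorm _)
  have hsum' : Summable fun m : Nat.factoredNumbers N.primeFactors =>
      (if m = ⟨1, h1M⟩ then (0 : ℂ) else Φ ((m : ℕ) : ZMod N) / ((m : ℕ) : ℂ)) :=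
    Summable.of_norm_bounded hBsum hle
  -- `Σ B = Σ_{1<d<N} μ_d ≤ Σ_{1<d<N} 1/φ(d)`
  have hBval : ∑' m, B m = ∑ d ∈ N.divisors.filter (fun d => 1 < d ∧ d < N),
      ∑' m : Nat.factoredNumbers N.primeFactors, (if Nat.gcd (m : ℕ) N = d then ((m : ℕ) : ℝ)⁻¹ else 0) := by
    rw [tsum_eq_sum_divisors_tsum_ite hN0 B hBsum, Finset.sum_filter]
    refine Finset.sum_congr rfl fun d _ => ?_
    by_cases hdS : 1 < d ∧ d < N
    · rw [if_pos hdS]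
      refine tsum_congr fun m => ?_
      by_cases hmd : Nat.gcd (m : ℕ) N = d
      · simp only [hmd, if_true, hB, hdS, and_self]
      · simp only [hmd, if_false]
    · rw [if_neg hdS]
      have hz : ∀ m : Nat.factoredNumbers N.primeFactors, (if Nat.gcd (m : ℕ) N = d then B m else 0) = 0 := by
        intro m
        by_cases hmd : Nat.gcd (m : ℕ) N = d
        · simp only [hB, hmd, hdS, if_true, if_false]
        · simp only [hmd, if_false]
      rw [tsum_congr hz, tsum_zero]
  calc (1 : ℝ) = ‖Φ 1‖ := hΦ1.symm
    _ = ‖∑' m : Nat.factoredNumbers N.primeFactors,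
          (if m = ⟨1, h1M⟩ then (0 : ℂ) else Φ ((m : ℕ) : ZMod N) / ((m : ℕ) : ℂ))‖ := by
        have h : Φ 1 = -∑' m : Nat.factoredNumbers N.primeFactors,
            (if m = ⟨1, h1M⟩ then (0 : ℂ) else Φ ((m : ℕ) : ZMod N) / ((m : ℕ) : ℂ)) := by
          have := hsplit
          simp only [Nat.cast_one, div_one] at this
          linear_combination -this
        rw [h, norm_neg]
    _ ≤ ∑' m : Nat.factoredNumbers N.primeFactors,
          ‖(if m = ⟨1, h1M⟩ then (0 : ℂ) else Φ ((m : ℕ) : ZMod N) / ((m : ℕ) : ℂ))‖ :=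
        norm_tsum_le_tsum_norm hsum'.norm
    _ ≤ ∑' m, B m := hsum'.norm.tsum_le_tsum hle hBsum
    _ = ∑ d ∈ N.divisors.filter (fun d => 1 < d ∧ d < N), ∑' m : Nat.factoredNumbers N.primeFactors,
          (if Nat.gcd (m : ℕ) N = d then ((m : ℕ) : ℝ)⁻¹ else 0) := hBval
    _ ≤ ∑ d ∈ N.divisors.filter (fun d => 1 < d ∧ d < N), 1 / (d.totient : ℝ) :=
        Finset.sum_le_sum fun d hd =>
          tsum_indicator_gcd_inv_le (Nat.dvd_of_mem_divisors (Finset.mem_filter.mp hd).1)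



omit [NeZero N] in
/-- An Erdősian `f : ℤ/N → ℂ` (`f(0) = 0`, `f = ±1` elsewhere) is the cast of a rational-valued function. [folklore] -/
private theorem exists_rat_cast_eq' (Φ : ZMod N → ℂ) (h0 : Φ 0 = 0)
    (hpm : ∀ b : ZMod N, b ≠ 0 → Φ b = 1 ∨ Φ b = -1) :
    ∃ f : ZMod N → ℚ, ∀ j, ((f j : ℚ) : ℂ) = Φ j := by
  classical
  refine ⟨fun j => if Φ j = 1 then 1 else if Φ j = -1 then -1 else 0, fun j => ?_⟩
  beta_reduce
  by_cases hj : j = 0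
  · have h1 : ¬ Φ j = 1 := by rw [hj, h0]; norm_num
    have h2 : ¬ Φ j = -1 := by rw [hj, h0]; norm_num
    rw [if_neg h1, if_neg h2, Rat.cast_zero, hj, h0]
  · rcases hpm j hj with h | h
    · rw [if_pos h, Rat.cast_one, h]
    · have h1 : ¬ Φ j = 1 := by rw [h]; norm_num
      rw [if_neg h1, if_pos h, Rat.cast_neg, Rat.cast_one, h]

/-- **Chatterjee–Murty 2015, Proposition 3.1: «If the Erdős conjecture is false (mod `q`) … then
`1 ≤ Σ_{d∣q, d≥3} 1/φ(d)`»** — here for every `N ≥ 2` in the sharper form `1 ≤ Σ_{d∣N, 1<d<N} 1/φ(d)`: if an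
Erdősian `f` (`f(0) = 0`, `f = ±1` else, `Σ_j f(j) = 0`) has `L(1,f) = 0`, Okada's criterion gives
`Σ_{m∈M(N)} f(m)/m = 0` and `one_le_sum_inv_totient_of_tsum_eq_zero` applies. [cite: ChatterjeeMurty2015, Proposition 3.1] -/
theorem one_le_sum_inv_totient_of_LFunction_one_eq_zero (hN : 2 ≤ N) (Φ : ZMod N → ℂ) (h0 : Φ 0 = 0)
    (hpm : ∀ b : ZMod N, b ≠ 0 → Φ b = 1 ∨ Φ b = -1) (hΦ : ∑ j : ZMod N, Φ j = 0)
    (hL : ZMod.LFunction Φ 1 = 0) :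
    (1 : ℝ) ≤ ∑ d ∈ N.divisors.filter (fun d => 1 < d ∧ d < N), 1 / (d.totient : ℝ) := by
  obtain ⟨f, hf⟩ := exists_rat_cast_eq' Φ h0 hpm
  have hfun : (fun j => ((f j : ℚ) : ℂ)) = Φ := funext hf
  have hfsum : ∑ j : ZMod N, ((f j : ℚ) : ℂ) = 0 := by simp_rw [hf]; exact hΦ
  have hL' : ZMod.LFunction (fun j => ((f j : ℚ) : ℂ)) 1 = 0 := by rw [hfun]; exact hL
  have hG := (okada_conditions_of_LFunction_one_eq_zero f hfsum hL').1 1 isUnit_one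
  simp_rw [mul_one, hf] at hG
  exact one_le_sum_inv_totient_of_tsum_eq_zero hN Φ h0 hpm hG

/-- **Proposition 3.1 as printed, odd `q`**: «If the Erdős conjecture is false (mod `q`) with `q` odd, then
`1 ≤ Σ_{d∣q, d≥3} 1/φ(d)`» (for odd `N` every divisor `d > 1` is `≥ 3`; the term `d = N` only enlarges the sum).
[cite: ChatterjeeMurty2015, Proposition 3.1] -/
theorem one_le_sum_inv_totient_of_odd (hodd : Odd N) (hN : 2 ≤ N) (Φ : ZMod N → ℂ) (h0 : Φ 0 = 0)
    (hpm : ∀ b : ZMod N, b ≠ 0 → Φ b = 1 ∨ Φ b = -1) (hΦ : ∑ j : ZMod N, Φ j = 0)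
    (hL : ZMod.LFunction Φ 1 = 0) :
    (1 : ℝ) ≤ ∑ d ∈ N.divisors.filter (fun d => 3 ≤ d), 1 / (d.totient : ℝ) := by
  refine (one_le_sum_inv_totient_of_LFunction_one_eq_zero hN Φ h0 hpm hΦ hL).trans ?_
  refine Finset.sum_le_sum_of_subset_of_nonneg (fun d hd => ?_) fun d _ _ => by positivity
  obtain ⟨hdiv, h1, _⟩ := by simpa [Finset.mem_filter] using hd
  refine Finset.mem_filter.mpr ⟨Nat.mem_divisors.mpr ⟨hdiv.1, hdiv.2⟩, ?_⟩
  -- a divisor `d > 1` of an odd number is odd, hence `≥ 3`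
  rcases Nat.even_or_odd d with hev | hod
  · exact absurd (hodd.of_dvd_nat hdiv.1) (Nat.not_odd_iff_even.mpr hev)
  · obtain ⟨k, rfl⟩ := hod
    omega

/-! ### Corollary 3.3: the smallest prime factor versus the number of divisors -/

omit [NeZero N] in
/-- `φ(d) ≥ minFac(N) − 1` for every divisor `d > 1` of `N`: the `minFac(d) − 1 ≥ minFac(N) − 1` integers
`1, …, minFac(d) − 1` are `< d` and coprime to `d`. [cite: ChatterjeeMurty2015, §3 (proof of Corollary 3.3: «`1/φ(d) < 1/φ(l)`»)] -/
theorem minFac_sub_one_le_totient {d : ℕ} (hdN : d ∣ N) (hd : 1 < d) :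
    (N.minFac : ℝ) - 1 ≤ (d.totient : ℝ) := by
  classical
  have hdmf : N.minFac ≤ d.minFac :=
    Nat.minFac_le_of_dvd (Nat.minFac_prime hd.ne').two_le ((Nat.minFac_dvd d).trans hdN)
  have hpd : d.minFac ≤ d := Nat.minFac_le (by omega)
  -- `{1, …, minFac d − 1} ⊆ {a < d : coprime}`
  have hsub : Finset.Ico 1 d.minFac ⊆ (Finset.range d).filter (fun a => d.Coprime a) := by
    intro a ha
    obtain ⟨ha1, hap⟩ := Finset.mem_Ico.mp ha
    refine Finset.mem_filter.mpr ⟨Finset.mem_range.mpr (lt_of_lt_of_le hap hpd), ?_⟩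
    rw [Nat.Coprime]
    by_contra hg
    have hg2 : 2 ≤ Nat.gcd d a := by
      have hpos : 0 < Nat.gcd d a := Nat.gcd_pos_of_pos_right _ (by omega)
      omega
    have hle : d.minFac ≤ Nat.gcd d a := Nat.minFac_le_of_dvd hg2 (Nat.gcd_dvd_left d a)
    have hle2 : Nat.gcd d a ≤ a := Nat.le_of_dvd (by omega) (Nat.gcd_dvd_right d a)
    omega
  have hcard := Finset.card_le_card hsub
  rw [Nat.card_Ico, ← Nat.totient_eq_card_coprime] at hcard
  have h1 : 1 ≤ N.minFac := Nat.minFac_pos N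
  have h' : N.minFac - 1 ≤ d.totient := by omega
  have := (Nat.cast_le (α := ℝ)).mpr h'
  rw [Nat.cast_sub h1, Nat.cast_one] at this
  exact this

/-- **Chatterjee–Murty 2015, Corollary 3.3: «If the smallest prime factor of `q` is at least `d(q)`, then the Erdős
conjecture is true for `q`»** (`d(q)` = the number of divisors). For `N ≥ 2` with `#divisors(N) ≤ minFac(N)` and an
Erdősian `f`, the partial sums `Σ_{n≤M} f(n)/n` do not tend to `0`: otherwise Proposition 3.1 gives
`1 ≤ Σ_{1<d<N, d∣N} 1/φ(d) ≤ (d(N) − 2)/(minFac N − 1) ≤ (l−2)/(l−1) < 1`. [cite: ChatterjeeMurty2015, Corollary 3.3] -/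
theorem erdos_conjecture_of_card_divisors_le_minFac (hN : 2 ≤ N) (hdiv : N.divisors.card ≤ N.minFac)
    (Φ : ZMod N → ℂ) (h0 : Φ 0 = 0) (hpm : ∀ b : ZMod N, b ≠ 0 → Φ b = 1 ∨ Φ b = -1) :
    ¬ Tendsto (fun M : ℕ => ∑ n ∈ range M, Φ ((n + 1 : ℕ) : ZMod N) / ((n + 1 : ℕ) : ℂ))
      atTop (𝓝 0) := by
  classical
  have hN0 : N ≠ 0 := NeZero.ne N
  by_cases hΦ : ∑ j : ZMod N, Φ j = 0
  swap
  · exact not_tendsto_sum_range_div Φ hΦ 0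
  intro ht
  have hL : ZMod.LFunction Φ 1 = 0 := (eq_LFunction_one_of_tendsto Φ ht).symm
  have h1 := one_le_sum_inv_totient_of_LFunction_one_eq_zero hN Φ h0 hpm hΦ hL
  set F := N.divisors.filter (fun d => 1 < d ∧ d < N) with hF
  set l := N.minFac with hl
  have hl2 : 2 ≤ l := (Nat.minFac_prime (by omega : N ≠ 1)).two_le
  have hl1 : (0 : ℝ) < (l : ℝ) - 1 := by
    have : (2 : ℝ) ≤ l := by exact_mod_cast hl2
    linarith
  -- each term is at most `1/(l−1)`
  have hterm : ∀ d ∈ F, 1 / (d.totient : ℝ) ≤ 1 / ((l : ℝ) - 1) := by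
    intro d hd
    obtain ⟨hdm, hd1, _⟩ := Finset.mem_filter.mp hd
    exact one_div_le_one_div_of_le hl1 (minFac_sub_one_le_totient (Nat.dvd_of_mem_divisors hdm) hd1)
  -- and there are at most `d(N) − 2` of them
  have hFcard : F.card ≤ N.divisors.card - 2 := by
    have hsub : F ⊆ N.divisors \ {1, N} := by
      intro d hd
      obtain ⟨hdm, hd1, hdN⟩ := Finset.mem_filter.mp hd
      refine Finset.mem_sdiff.mpr ⟨hdm, ?_⟩
      simp only [Finset.mem_insert, Finset.mem_singleton, not_or]
      exact ⟨by omega, by omega⟩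
    have h2 : ({1, N} : Finset ℕ) ⊆ N.divisors := by
      intro d hd
      simp only [Finset.mem_insert, Finset.mem_singleton] at hd
      rcases hd with h | h
      · rw [h]; exact Nat.one_mem_divisors.mpr hN0
      · rw [h]; exact Nat.mem_divisors_self N hN0
    have hc2 : ({1, N} : Finset ℕ).card = 2 := Finset.card_pair (by omega)
    calc F.card ≤ (N.divisors \ {1, N}).card := Finset.card_le_card hsub
      _ = N.divisors.card - 2 := by rw [Finset.card_sdiff_of_subset h2, hc2]
  have hsum : ∑ d ∈ F, 1 / (d.totient : ℝ) ≤ ((l : ℝ) - 2) / ((l : ℝ) - 1) := by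
    calc ∑ d ∈ F, 1 / (d.totient : ℝ) ≤ ∑ _d ∈ F, 1 / ((l : ℝ) - 1) := Finset.sum_le_sum hterm
      _ = F.card * (1 / ((l : ℝ) - 1)) := by rw [Finset.sum_const, nsmul_eq_mul]
      _ ≤ ((l : ℝ) - 2) * (1 / ((l : ℝ) - 1)) := by
          refine mul_le_mul_of_nonneg_right ?_ (by positivity)
          have h3 : (F.card : ℝ) ≤ ((N.divisors.card - 2 : ℕ) : ℝ) := by exact_mod_cast hFcard
          have h4 : ((N.divisors.card - 2 : ℕ) : ℝ) ≤ (l : ℝ) - 2 := by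
            have h2le : 2 ≤ N.divisors.card := by
              have : ({1, N} : Finset ℕ) ⊆ N.divisors := by
                intro d hd
                simp only [Finset.mem_insert, Finset.mem_singleton] at hd
                rcases hd with h | h
                · rw [h]; exact Nat.one_mem_divisors.mpr hN0
                · rw [h]; exact Nat.mem_divisors_self N hN0
              have := Finset.card_le_card this
              rwa [Finset.card_pair (by omega : (1 : ℕ) ≠ N)] at this
            rw [Nat.cast_sub h2le]
            have : (N.divisors.card : ℝ) ≤ l := by exact_mod_cast hdiv
            push_cast
            linarith
          exact h3.trans h4
      _ = ((l : ℝ) - 2) / ((l : ℝ) - 1) := by ring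
  have hlt : ((l : ℝ) - 2) / ((l : ℝ) - 1) < 1 := by
    rw [div_lt_one hl1]
    linarith
  linarith

end OkadaCriterion

end Literature.NumberTheory.Transcendental

end
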